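import Literature.Algebra.Homology.InfiniteCyclicQuotientCohomology
import Literature.Algebra.Homology.CoinducedConjugation
import Literature.LinearAlgebra.ScalarFiltration
import Mathlib.Algebra.Homology.HomologySequenceLemmas
import HarnessLib

/-!
# Scalar-type filtrations ascend along infinite cyclic extensions (equivariant Wang sequence)

Topic `Algebra/Homology`; namespace `Literature.Algebra.Homology`.  Definitions with bodies and
theorems; Mathlib + `InfiniteCyclicQuotientCohomology` (the Wang sequence from
`0 → A → Coind_H^G Res A → Coind_H^G Res A → 0`) + `CoinducedConjugation`/`ShapiroExplicit`
(the Shapiro map is injective) + `ScalarFiltration`.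

Let `H ⊴ G` with `G / H` infinite cyclic generated by `t H`, `A` a representation of `G` over a
field `k`, and `(c_x, φ_x)_{x ∈ X}` a family of PAIR ENDOMORPHISMS of `(G, A)` — `c_x : G →* G`,
`φ_x : A ∘ c_x ⟶ A` — with `c_x(H) ⊆ H` and `c_x(t) = t`.  Then the pair maps act compatibly on
the whole Wang sequence:

* `coindPair` — the pair endomorphism `(φ̃ f)(g) = φ(f(c g))` of `Coind_H^G Res_H A` over `c`,
  compatible with the constant embedding (`cochainsMap_toCoindRes_comm`) and — as `c t = t` — with
  the shift (`cochainsMap_shiftHom_comm`), whence a morphism of the short complex of cochain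
  complexes (`pairShortComplexHom`) and the `δ`-NATURALITY of the Wang sequence;
* `shapiroMap_coindPair` — under the (injective) Shapiro map `Hⁿ(G, Coind) → Hⁿ(H, A)` the pair
  map of `φ̃` is the pair map of `(c|_H, φ)`;
* `scalarFiltered_of_infiniteCyclicExtension` — **if the pair maps `Hⁿ(c_x|_H, φ_x)` on `Hⁿ(H, A)`
  are scalar-filtered with characters `S` for all `n`, so are the pair maps `Hⁿ(c_x, φ_x)` on
  `Hⁿ(G, A)`** (`ScalarFiltered.of_exact` on `Hⁿ(H, A) → Hⁿ⁺¹(G, A) → Hⁿ⁺¹(H, A)`, and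
  `H⁰(G, A) ↪ H⁰(G, Coind)` in degree `0`).

This is the dévissage along the unit directions `Γ_U ⋊ ⟨u₁, …, uⱼ⟩ ⊴ Γ_U ⋊ ⟨u₁, …, uⱼ₊₁⟩` of the
arithmetic subgroups of a Borel, for the torus operators (which fix the units)
[Harder1987, §2, (2.3)–(2.7)]; [Brown1982CohomologyGroups, III §6–§8].

## References

* K. S. Brown, *Cohomology of Groups*, GTM 87 (1982), III §6–§8 [Brown1982CohomologyGroups].
* G. Harder, *Eisenstein cohomology of arithmetic groups. The case GL₂*, Invent. Math. 89 (1987), §2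
  [Harder1987].
-/

noncomputable section

open CategoryTheory CategoryTheory.Limits groupCohomology Literature.LinearAlgebra

universe u

namespace Literature.Algebra.Homology

variable {k G : Type u} [CommRing k] [Group G] (H : Subgroup G) (A : Rep.{u} k G)

/-! ### The pair endomorphism of `Coind_H^G Res_H A` over `c` -/

section Pair

variable (c : G →* G) (hc : ∀ h ∈ H, c h ∈ H) (φ : Rep.res c A ⟶ A)

/-- `φ` intertwines: `φ(c(g) · a) = g · φ(a)`. [folklore] -/
theorem pair_hom_comm_apply (g : G) (a : A) : φ.hom (A.ρ (c g) a) = A.ρ g (φ.hom a) :=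
  Rep.hom_comm_apply φ g a

/-- **`(φ̃ f)(g) = φ(f(c g))`** on `Coind_H^G Res_H A`, as a linear map. [folklore] -/
def coindPairLinear : coindRes H A →ₗ[k] coindRes H A where
  toFun f := ⟨fun g => φ.hom (f.1 (c g)), fun h g => by
    change φ.hom (f.1 (c ((h : G) * g))) = A.ρ (h : G) (φ.hom (f.1 (c g)))
    rw [map_mul, coindRes_apply_mul H A f ⟨c h, hc h h.2⟩ (c g)]
    exact pair_hom_comm_apply A c φ (h : G) _⟩
  map_add' f f' := Subtype.ext (funext fun g => by
    change φ.hom ((f.1 + f'.1) (c g)) = φ.hom (f.1 (c g)) + φ.hom (f'.1 (c g))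
    rw [Pi.add_apply, map_add])
  map_smul' r f := Subtype.ext (funext fun g => by
    change φ.hom ((r • f.1) (c g)) = r • φ.hom (f.1 (c g))
    rw [Pi.smul_apply, map_smul])

/-- Unfolding `coindPairLinear`. [folklore] -/
@[simp]
theorem coindPairLinear_apply_coe (f : coindRes H A) (g : G) :
    ((coindPairLinear H A c hc φ f : coindRes H A) : G → A) g = φ.hom (f.1 (c g)) := rfl

/-- **The pair endomorphism `φ̃ : Coind ∘ c ⟶ Coind`** (it is `G`-equivariant over `c`). [folklore] -/
def coindPair : Rep.res c (coindRes H A) ⟶ coindRes H A :=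
  Rep.ofHom (LinearMap.intertwiningMap_of_isIntertwiningMap _ _ (coindPairLinear H A c hc φ) fun g f =>
    Subtype.ext (funext fun x => by
      change φ.hom (f.1 (c x * c g)) = φ.hom (f.1 (c (x * g)))
      rw [map_mul]))

/-- Unfolding `coindPair`. [folklore] -/
@[simp]
theorem coindPair_hom_apply_coe (f : coindRes H A) (g : G) :
    (((coindPair H A c hc φ).hom f : coindRes H A) : G → A) g = φ.hom (f.1 (c g)) := rfl

/-- **Compatibility with the constant embedding** `A → Coind`: the square of cochain maps commutes.
[folklore] -/
theorem cochainsMap_toCoindRes_comm :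
    cochainsMap c φ ≫ cochainsMap (MonoidHom.id G) (toCoindRes H A) =
      cochainsMap (MonoidHom.id G) (toCoindRes H A) ≫ cochainsMap c (coindPair H A c hc φ) := by
  rw [← cochainsMap_comp, ← cochainsMap_comp]
  refine cochainsMap_congr rfl (LinearMap.ext fun a => Subtype.ext (funext fun x => ?_))
  change A.ρ x (φ.hom a) = φ.hom (A.ρ (c x) a)
  rw [pair_hom_comm_apply]

variable [H.Normal] (t : G) (hct : c t = t)

include hct in
/-- **Compatibility with the shift** (as `c t = t`). [folklore] -/
theorem cochainsMap_shiftHom_comm :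
    cochainsMap c (coindPair H A c hc φ) ≫ cochainsMap (MonoidHom.id G) (shiftHom H A t) =
      cochainsMap (MonoidHom.id G) (shiftHom H A t) ≫ cochainsMap c (coindPair H A c hc φ) := by
  rw [← cochainsMap_comp, ← cochainsMap_comp]
  refine cochainsMap_congr rfl (LinearMap.ext fun f => Subtype.ext (funext fun x => ?_))
  change A.ρ t⁻¹ (φ.hom (f.1 (c (t * x)))) = φ.hom (A.ρ t⁻¹ (f.1 (t * c x)))
  rw [map_mul, hct]
  have h := pair_hom_comm_apply A c φ t⁻¹ (f.1 (t * c x))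
  rw [map_inv, hct] at h
  exact h.symm

include hct in
/-- The pair maps as a morphism of the short complex of cochain complexes of the Wang sequence.
[folklore] -/
def pairShortComplexHom :
    (shiftComplex H A t).map (cochainsFunctor k G) ⟶ (shiftComplex H A t).map (cochainsFunctor k G) where
  τ₁ := cochainsMap c φ
  τ₂ := cochainsMap c (coindPair H A c hc φ)
  τ₃ := cochainsMap c (coindPair H A c hc φ)
  comm₁₂ := cochainsMap_toCoindRes_comm H A c hc φ
  comm₂₃ := by
    have h1 := cochainsMap_shiftHom_comm H A c hc φ t hct
    have hsub : cochainsMap (MonoidHom.id G) (shiftHom H A t - 𝟙 (coindRes H A)) =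
        cochainsMap (MonoidHom.id G) (shiftHom H A t) - 𝟙 (inhomogeneousCochains (coindRes H A)) := by
      have := (cochainsFunctor k G).map_sub (X := coindRes H A) (Y := coindRes H A) (f := shiftHom H A t) (g := 𝟙 _)
      rw [CategoryTheory.Functor.map_id] at this
      exact this
    show cochainsMap c (coindPair H A c hc φ) ≫ cochainsMap (MonoidHom.id G) (shiftHom H A t - 𝟙 (coindRes H A)) =
      cochainsMap (MonoidHom.id G) (shiftHom H A t - 𝟙 (coindRes H A)) ≫ cochainsMap c (coindPair H A c hc φ)
    rw [hsub, Preadditive.comp_sub, Preadditive.sub_comp, Category.comp_id, Category.id_comp, h1]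

end Pair

/-! ### The Shapiro map and the pair maps -/

section Shapiro

variable (c : G →* G) (hc : ∀ h ∈ H, c h ∈ H) (φ : Rep.res c A ⟶ A)

/-- The restriction `c|_H : H →* H`. [folklore] -/
def restrictEnd : H →* H :=
  (c.comp H.subtype).codRestrict H fun h => hc h h.2

/-- Unfolding `restrictEnd`. [folklore] -/
@[simp]
theorem coe_restrictEnd_apply (h : H) : (restrictEnd H c hc h : G) = c h := rfl

/-- The pair map `φ` on the restriction to `H`. [folklore] -/
def resPair : Rep.res (restrictEnd H c hc) (resSub H A) ⟶ resSub H A :=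
  Rep.ofHom (LinearMap.intertwiningMap_of_isIntertwiningMap _ _ φ.hom.toLinearMap fun h a => by
    change φ.hom (A.ρ ((restrictEnd H c hc h : H) : G) a) = A.ρ (h : G) (φ.hom a)
    rw [coe_restrictEnd_apply]
    exact pair_hom_comm_apply A c φ (h : G) a)

/-- Unfolding `resPair`. [folklore] -/
@[simp]
theorem resPair_hom_apply (a : A) : (resPair H A c hc φ).hom a = φ.hom a := rfl

/-- **The Shapiro map intertwines the pair map of `φ̃` on `Hⁿ(G, Coind)` with the pair map of
`(c|_H, φ)` on `Hⁿ(H, A)`.** [cite: Brown1982CohomologyGroups, III §6 and §8] -/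
theorem shapiroMap_coindPair (n : ℕ) :
    groupCohomology.map c (coindPair H A c hc φ) n ≫ groupCohomology.map H.subtype (coindEv H A) n =
      groupCohomology.map H.subtype (coindEv H A) n ≫
        groupCohomology.map (restrictEnd H c hc) (resPair H A c hc φ) n := by
  rw [← groupCohomology.map_comp, ← groupCohomology.map_comp]
  refine map_congr' ?_ _ _ (fun f => ?_) n
  · ext h
    rfl
  · change φ.hom (f.1 (c 1)) = φ.hom (f.1 1)
    rw [map_one]

/-- Element form. [folklore] -/
theorem shapiroMap_coindPair_apply (n : ℕ) (y : groupCohomology (coindRes H A) n) :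
    (groupCohomology.map H.subtype (coindEv H A) n).hom ((groupCohomology.map c (coindPair H A c hc φ) n).hom y) =
      (groupCohomology.map (restrictEnd H c hc) (resPair H A c hc φ) n).hom
        ((groupCohomology.map H.subtype (coindEv H A) n).hom y) := by
  have h := shapiroMap_coindPair H A c hc φ n
  have := congrArg (fun ψ => ψ.hom y) h
  simpa only [ModuleCat.hom_comp, LinearMap.comp_apply] using this

end Shapiro

/-! ### The ascent -/

section Ascent

variable {k G : Type u} [Field k] [Group G] (H : Subgroup G) [H.Normal] (A : Rep.{u} k G) (t : G)
  (hgen : ∀ g : G, ∃ (h : H) (n : ℤ), g = (h : G) * t ^ n) (hfree : ∀ n : ℤ, t ^ n ∈ H → n = 0)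
  {X : Type*} (c : X → (G →* G)) (hc : ∀ x, ∀ h ∈ H, c x h ∈ H) (hct : ∀ x, c x t = t)
  (φ : ∀ x, Rep.res (c x) A ⟶ A) (S : Set (X → k))

omit [H.Normal] in
/-- The pair maps of `φ̃` on `Hⁿ(G, Coind)` are scalar-filtered when those of `(c|_H, φ)` on
`Hⁿ(H, A)` are (transport along the injective Shapiro map). [folklore] -/
theorem scalarFiltered_coind (n : ℕ)
    (hH : ScalarFiltered (fun x => (groupCohomology.map (restrictEnd H (c x) (hc x)) (resPair H A (c x) (hc x) (φ x)) n).hom) S ⊤) :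
    ScalarFiltered (fun x => (groupCohomology.map (c x) (coindPair H A (c x) (hc x) (φ x)) n).hom) S ⊤ :=
  ScalarFiltered.of_injective (groupCohomology.map H.subtype (coindEv H A) n).hom (shapiroMap_injective H A n)
    (fun x y => shapiroMap_coindPair_apply H A (c x) (hc x) (φ x) n y) hH

include hgen hfree hct in
/-- **Scalar-type filtrations ascend along infinite cyclic extensions.**  Let `H ⊴ G` with `G / H`
infinite cyclic generated by `t H`, `A` a representation of `G` over a field, and `(c_x, φ_x)` pair
endomorphisms of `(G, A)` with `c_x(H) ⊆ H` and `c_x(t) = t`.  If for every `n` the pair maps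
`Hⁿ(c_x|_H, φ_x)` on `Hⁿ(H, A)` are scalar-filtered with characters `S`, then for every `n` so are the
pair maps `Hⁿ(c_x, φ_x)` on `Hⁿ(G, A)`. [cite: Brown1982CohomologyGroups, III §6–§8]
[cite: Harder1987, §2] -/
theorem scalarFiltered_of_infiniteCyclicExtension
    (hH : ∀ n, ScalarFiltered
      (fun x => (groupCohomology.map (restrictEnd H (c x) (hc x)) (resPair H A (c x) (hc x) (φ x)) n).hom) S ⊤)
    (n : ℕ) : ScalarFiltered (fun x => (groupCohomology.map (c x) (φ x) n).hom) S ⊤ := by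
  have hX := shortExact_shiftComplex H A t hgen hfree
  have hS := groupCohomology.map_cochainsFunctor_shortExact hX
  -- the map `Hᵐ(G, A) → Hᵐ(G, Coind)` commutes with the pair maps
  have hcomm : ∀ (m : ℕ) (x : X) (v : groupCohomology A m),
      (groupCohomology.map (MonoidHom.id G) (toCoindRes H A) m).hom ((groupCohomology.map (c x) (φ x) m).hom v) =
        (groupCohomology.map (c x) (coindPair H A (c x) (hc x) (φ x)) m).hom
          ((groupCohomology.map (MonoidHom.id G) (toCoindRes H A) m).hom v) := by
    intro m x v
    have h : groupCohomology.map (c x) (φ x) m ≫ groupCohomology.map (MonoidHom.id G) (toCoindRes H A) m =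
        groupCohomology.map (MonoidHom.id G) (toCoindRes H A) m ≫
          groupCohomology.map (c x) (coindPair H A (c x) (hc x) (φ x)) m := by
      change HomologicalComplex.homologyMap (cochainsMap (c x) (φ x)) m ≫
          HomologicalComplex.homologyMap (cochainsMap (MonoidHom.id G) (toCoindRes H A)) m =
        HomologicalComplex.homologyMap (cochainsMap (MonoidHom.id G) (toCoindRes H A)) m ≫
          HomologicalComplex.homologyMap (cochainsMap (c x) (coindPair H A (c x) (hc x) (φ x))) m
      rw [← HomologicalComplex.homologyMap_comp, ← HomologicalComplex.homologyMap_comp,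
        cochainsMap_toCoindRes_comm]
    have := congrArg (fun ψ => ψ.hom v) h
    simpa only [ModuleCat.hom_comp, LinearMap.comp_apply] using this
  rcases n with _ | n
  · -- degree `0`: `H⁰(G, A) ↪ H⁰(G, Coind)`
    have hinj : Function.Injective (groupCohomology.map (MonoidHom.id G) (toCoindRes H A) 0).hom := by
      haveI : Mono (toCoindRes H A) := hX.mono_f
      have hm : Mono (groupCohomology.map (MonoidHom.id G) (toCoindRes H A) 0) := inferInstance
      exact (ModuleCat.mono_iff_injective _).1 hm
    exact ScalarFiltered.of_injective _ hinj (fun x v => hcomm 0 x v) (scalarFiltered_coind H A c hc φ S 0 (hH 0))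
  · -- degree `n + 1`: exactness of `Hⁿ(G, Coind) → Hⁿ⁺¹(G, A) → Hⁿ⁺¹(G, Coind)`
    have hex := (groupCohomology.mapShortComplex₁_exact hX (i := n) (j := n + 1) rfl).moduleCat_range_eq_ker
    refine ScalarFiltered.of_exact
      (T' := fun x => (groupCohomology.map (c x) (coindPair H A (c x) (hc x) (φ x)) n).hom)
      (T'' := fun x => (groupCohomology.map (c x) (coindPair H A (c x) (hc x) (φ x)) (n + 1)).hom)
      (groupCohomology.mapShortComplex₁ hX (i := n) (j := n + 1) rfl).f.hom
      (groupCohomology.mapShortComplex₁ hX (i := n) (j := n + 1) rfl).g.hom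
      (fun x v => ?_) (fun x v => hcomm (n + 1) x v) hex
      (scalarFiltered_coind H A c hc φ S n (hH n)) (scalarFiltered_coind H A c hc φ S (n + 1) (hH (n + 1)))
    -- `δ`-naturality for the pair morphism of the Wang short complex
    have hδ := HomologicalComplex.HomologySequence.δ_naturality
      (pairShortComplexHom H A (c x) (hc x) (φ x) t (hct x)) hS hS n (n + 1) rfl
    have := congrArg (fun ψ => ψ.hom v) hδ
    simp only [ModuleCat.hom_comp, LinearMap.comp_apply] at this
    exact this.symm

end Ascent

end Literature.Algebra.Homology

end
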